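import Summits.BirchSwinnertonDyer.BirchSwinnertonDyer.Theorems.UniversalToricDescentThinCombPencilRigidity
import HarnessLib

/-!
# Thin-comb rigidity in PENCIL currency, II: TWO PENCILS (helper on the rational wall `RationalSplitIMCInclusionAtThree`,
# item stmt-BirchSwinnertonDyer-24207, line `ratwall_thin_comb`; cell `pub/bsd-wall`, LEAD `cruxlead-24207` g6;
# `--supports stmt-BirchSwinnertonDyer-24207`)

WHY THIS FILE. Part I (`…ThinComb.PencilRigidity`) showed that ONE rational comb already gives integral divisibility as soon
as `G ∉ (p, T₂)`. This part isolates what the line's rigidity step (Part VII `dvd_pow_mul_of_weakReflection`, consumed by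
`_of` of skeleton v7 with `ρ := φ_{A_τ}`) REALLY uses of the two functional equations `ρ G ∼ G`, `ρ L₂ ∼ L₂` (card items
K4 ⊕ K3(iii)): a SECOND PENCIL, the rational comb of the transported pair `(ρ⁻¹ G, ρ⁻¹ F)` — equivalently the comb of
`(G, F)` along the reflected teeth `ρ E_m(T₂)` (pencil audit P2, memo `Cruxes/RationalSplitIMCInclusionAtThree/LENS-MEMO-utd-idea-g63.md` §2.2).

* §1 **TWO-PENCIL RIGIDITY** (`dvd_pow_mul_of_two_pencils`, integral twin `dvd_of_two_pencils`): for every DVR `𝒪` with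
  maximal ideal `(p)` and every constant-fixing automorphism `ρ` of `𝒪⟦T₂⟧⟦T₁⟧` with `ρ T₂ ∉ (p, T₂)`, the rational combs
  of `(G, F)` and of `(ρ⁻¹ G, ρ⁻¹ F)` give `G ∣ p^a F` — NO self-symmetry of `G` or `F`. Trichotomy for a prime `P` of the
  `p`-free part: `P ∉ (p, T₂)` visible on the first pencil; `P ∈ (p, T₂) ∩ (p, ρT₂)` visible on deep levels of the first
  pencil (Part VI); `P ∈ (p, T₂) ∖ (p, ρT₂)`: `ρ⁻¹P ∉ (p, T₂)` is visible on the SECOND pencil.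
* §1 corollaries: Part VII (`dvd_pow_mul_of_weakReflection`, not restated) is the special case where the second pencil is
  manufactured from the first (`PencilRigidity.ThinCombDvdRat.symm_of_associated`); ONE-SIDED functional equations `G ∣ ρ G`, `ρ F ∣ F` already suffice
  (`dvd_pow_mul_of_oneSided`) — a weakening of Part VII for non-involutive `ρ` (for involutive `ρ`, e.g. `φ_{A_τ}`, they
  are equivalent to `Associated`, `…ThinComb.InvolutiveReflection`).
* §2 the group-like currency `ρ = φ_A`, `A ∈ GL₂(ℤ_p)`, `A 0 1 ≠ 0` (`φ_A⁻¹ = φ_{A⁻¹}`), over any such `𝒪` and over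
  the receptacle `R₀ = unrIntegers p`.

READING FOR THE LINE: inside the bounded-supply census of the crux (memo §3 (B2)) no Euler system supplies the second
pencil of the SAME pair `(G, L₂)` directly; the functional equations of v7 are the print-adjacent way to obtain it from the
first. Pure commutative algebra; nothing about elliptic curves; BSD is not proved by any of this.

References: Washington, *Introduction to Cyclotomic Fields*, §7.1–7.2, §13.4 [cite: Washington1997, §7.1–§7.2 and §13.4];
Matsumura, *Commutative Ring Theory*, Thm. 20.3 [cite: Matsumura1987, Thm. 20.3]; Neukirch–Schmidt–Wingberg (5.3.5)
[cite: NeukirchSchmidtWingberg2008, (5.3.5)].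
-/

set_option linter.dupNamespace false
set_option autoImplicit false

noncomputable section

open scoped MatrixGroups
open Literature.NumberTheory.EllipticCurves

namespace Summit.BirchSwinnertonDyer.BirchSwinnertonDyer.Theorems.UniversalToricDescentThinComb.TwoPencilRigidity

open Summit.BirchSwinnertonDyer.Rank1Residual.X11b.Halves
open Summit.BirchSwinnertonDyer.BirchSwinnertonDyer.Theorems.UniversalToricDescentThinComb.PencilRigidity

/-! ## §1 Two pencils: the combs of `(G, F)` and of `(ρ⁻¹ G, ρ⁻¹ F)` give rigidity -/

section TwoPencils

variable (𝒪 : Type*) [CommRing 𝒪] [IsDomain 𝒪] [IsDiscreteValuationRing 𝒪] (p : ℕ) [hp : Fact p.Prime]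

/-- **The `p`-free part divides `F` — two-pencil form.** `ρ` fixes constants, `ρ T₂ ∉ (p, T₂)`; `G₀ ≠ 0`, `p ∤ G₀`;
rational comb levels for `(G₀, F)` AND for `(ρ⁻¹ G₀, ρ⁻¹ F)`. Then `G₀ ∣ F`. Trichotomy for a prime `P ∣ G₀`:
`P ∉ (p, T₂)` visible on every level of the first pencil; `P ∈ (p, T₂) ∩ (p, ρT₂)` visible on deep levels of the first
pencil (Part VI); `P ∈ (p, T₂) ∖ (p, ρT₂)`: `ρ⁻¹ P ∉ (p, T₂)` divides `ρ⁻¹ G₀` and is visible on every level of the SECOND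
pencil, so `(ρ⁻¹P)^k ∣ ρ⁻¹F`, i.e. `P^k ∣ F`. No symmetry of `G₀` or `F` is assumed.
[cite: Washington1997, §7.1–§7.2 and §13.4; Matsumura1987, Thm. 20.3] -/
theorem pfree_dvd_of_two_pencils (hmax : IsLocalRing.maximalIdeal 𝒪 = Ideal.span {(p : 𝒪)})
    {ρ : PowerSeries (PowerSeries 𝒪) ≃+* PowerSeries (PowerSeries 𝒪)} (hρc : ∀ c : 𝒪, ρ (const 𝒪 c) = const 𝒪 c)
    (hρT : ρ (T₂ 𝒪) ∉ Ideal.span {const 𝒪 (p : 𝒪), T₂ 𝒪})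
    {G₀ F : PowerSeries (PowerSeries 𝒪)} (hG₀0 : G₀ ≠ 0) (hG₀p : ¬ const 𝒪 (p : 𝒪) ∣ G₀)
    (hlev : ∀ n : ℕ, ∃ m : ℕ, n ≤ m ∧ ∃ t : ℕ, const 𝒪 ((p : 𝒪) ^ t) * F ∈ Ideal.span {G₀, combElt 𝒪 p m})
    (hlev' : ∀ n : ℕ, ∃ m : ℕ, n ≤ m ∧
      ∃ t : ℕ, const 𝒪 ((p : 𝒪) ^ t) * ρ.symm F ∈ Ideal.span {ρ.symm G₀, combElt 𝒪 p m}) :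
    G₀ ∣ F := by
  classical
  obtain ⟨hp0, hpu, hprime, hpprime⟩ := p_ne_zero_of_maximalIdeal_eq 𝒪 p hmax
  haveI := Literature.NumberTheory.IwasawaTheory.uniqueFactorizationMonoid_powerSeries_powerSeries 𝒪
  have hcp : Prime (const 𝒪 (p : 𝒪)) :=
    Literature.NumberTheory.EllipticCurves.prime_C_of_prime (Literature.NumberTheory.EllipticCurves.prime_C_of_prime hpprime)
  have hlevD : ∀ D, D ∣ G₀ → ∀ n : ℕ, ∃ m : ℕ, n ≤ m ∧
      ∃ t : ℕ, const 𝒪 ((p : 𝒪) ^ t) * F ∈ Ideal.span {D, combElt 𝒪 p m} := by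
    rintro D ⟨c, rfl⟩ n
    obtain ⟨m, hnm, t, hmem⟩ := hlev n
    obtain ⟨a, b, hab⟩ := Ideal.mem_span_pair.mp hmem
    exact ⟨m, hnm, t, Ideal.mem_span_pair.mpr ⟨a * c, b, by rw [← hab]; ring⟩⟩
  have hlevD' : ∀ D, D ∣ ρ.symm G₀ → ∀ n : ℕ, ∃ m : ℕ, n ≤ m ∧
      ∃ t : ℕ, const 𝒪 ((p : 𝒪) ^ t) * ρ.symm F ∈ Ideal.span {D, combElt 𝒪 p m} := by
    rintro D ⟨c, hc⟩ n
    obtain ⟨m, hnm, t, hmem⟩ := hlev' n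
    obtain ⟨a, b, hab⟩ := Ideal.mem_span_pair.mp hmem
    exact ⟨m, hnm, t, Ideal.mem_span_pair.mpr ⟨a * c, b, by rw [← hab, hc]; ring⟩⟩
  -- image of `(p, T₂)` under `ρ` is `(p, ρT₂)`
  have hmap : Ideal.map (ρ : PowerSeries (PowerSeries 𝒪) →+* PowerSeries (PowerSeries 𝒪))
      (Ideal.span {const 𝒪 (p : 𝒪), T₂ 𝒪}) = Ideal.span {const 𝒪 (p : 𝒪), ρ (T₂ 𝒪)} := by
    rw [Ideal.map_span, Set.image_pair, RingHom.coe_coe, hρc]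
  have hρTu : ¬ IsUnit (ρ (T₂ 𝒪)) := fun h => by
    have : IsUnit (T₂ 𝒪) := by simpa using h.map ρ.symm
    rw [T₂, PowerSeries.isUnit_iff_constantCoeff, PowerSeries.constantCoeff_C, PowerSeries.isUnit_iff_constantCoeff,
      PowerSeries.constantCoeff_X] at this
    exact not_isUnit_zero this
  refine UniqueFactorizationMonoid.induction_on_coprime (P := fun D => D ∣ G₀ → D ∣ F) G₀ ?_ ?_ ?_ ?_ dvd_rfl
  · intro h; exact absurd (zero_dvd_iff.mp h) hG₀0
  · intro x hx _; exact hx.dvd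
  · intro P k hP hPk
    rcases k with _ | k
    · simp
    have hPp : ¬ P ∣ const 𝒪 (p : 𝒪) := fun h =>
      hG₀p ((hP.irreducible.associated_of_dvd hcp.irreducible h).symm.dvd.trans
        ((dvd_pow_self P (Nat.succ_ne_zero k)).trans hPk))
    have hPc : ¬ const 𝒪 (p : 𝒪) ∣ P := fun h =>
      hPp (hcp.irreducible.associated_of_dvd hP.irreducible h).symm.dvd
    by_cases h2 : P ∈ Ideal.span {const 𝒪 (p : 𝒪), T₂ 𝒪}
    · by_cases h1 : P ∈ Ideal.span {const 𝒪 (p : 𝒪), ρ (T₂ 𝒪)}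
      · -- visible on all deep levels of the first pencil (Part VI with `S = ρ T₂`)
        obtain ⟨m₀, hm₀⟩ := exists_level_not_shape_of_mem_span_pair 𝒪 p hmax hρTu hρT h2 h1 hPc
        refine pow_dvd_of_visible_levels 𝒪 p hmax hP hPp (k + 1) F (levels_avoiding 𝒪 p hPp fun n => ?_)
        obtain ⟨m, hnm, hmem⟩ := hlevD _ hPk (max n m₀)
        exact ⟨m, le_of_max_le_left hnm, visible_of_not_shape 𝒪 p hmax m (hm₀ m (le_of_max_le_right hnm)), hmem⟩
      · -- `Q = ρ⁻¹ P ∉ (p, T₂)` divides `ρ⁻¹ G₀`: the SECOND pencil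
        have hQ : Prime (ρ.symm P) := (MulEquiv.prime_iff ρ.symm).mpr hP
        have hQ2 : ρ.symm P ∉ Ideal.span {const 𝒪 (p : 𝒪), T₂ 𝒪} := by
          intro hmem
          apply h1
          have := Ideal.mem_map_of_mem (ρ : PowerSeries (PowerSeries 𝒪) →+* PowerSeries (PowerSeries 𝒪)) hmem
          rwa [hmap, RingHom.coe_coe, RingEquiv.apply_symm_apply] at this
        have hQp : ¬ ρ.symm P ∣ const 𝒪 (p : 𝒪) := fun h => hPp (by
          have := map_dvd (ρ : PowerSeries (PowerSeries 𝒪) →+* PowerSeries (PowerSeries 𝒪)) h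
          rwa [RingHom.coe_coe, RingEquiv.apply_symm_apply, hρc] at this)
        have hQk : ρ.symm P ^ (k + 1) ∣ ρ.symm G₀ := by
          rw [← map_pow]; exact map_dvd ρ.symm hPk
        have hQF : ρ.symm P ^ (k + 1) ∣ ρ.symm F := by
          refine pow_dvd_of_visible_levels 𝒪 p hmax hQ hQp (k + 1) (ρ.symm F)
            (levels_avoiding 𝒪 p hQp fun n => ?_)
          obtain ⟨m, hnm, hmem⟩ := hlevD' _ hQk n
          exact ⟨m, hnm, visible_of_not_shape 𝒪 p hmax m
            (not_shape_of_not_mem_span_T₂ 𝒪 p m hmax hQ2 hQ.not_unit), hmem⟩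
        have := map_dvd (ρ : PowerSeries (PowerSeries 𝒪) →+* PowerSeries (PowerSeries 𝒪)) hQF
        rwa [RingHom.coe_coe, map_pow, RingEquiv.apply_symm_apply, RingEquiv.apply_symm_apply] at this
    · refine pow_dvd_of_visible_levels 𝒪 p hmax hP hPp (k + 1) F (levels_avoiding 𝒪 p hPp fun n => ?_)
      obtain ⟨m, hnm, hmem⟩ := hlevD _ hPk n
      exact ⟨m, hnm, visible_of_not_shape 𝒪 p hmax m (not_shape_of_not_mem_span_T₂ 𝒪 p m hmax h2 hP.not_unit),
        hmem⟩
  · intro x y hxy hx hy hdvd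
    exact hxy.mul_dvd (hx (dvd_of_mul_right_dvd hdvd)) (hy (dvd_of_mul_left_dvd hdvd))

/-- **TWO-PENCIL RIGIDITY, rational form (P2 of the pencil audit).** For every DVR `𝒪` with maximal ideal `(p)` and
every constant-fixing automorphism `ρ` of `𝒪⟦T₂⟧⟦T₁⟧` with `ρ T₂ ∉ (p, T₂)`: the rational combs of `(G, F)` and of
`(ρ⁻¹ G, ρ⁻¹ F)` imply `G ∣ p^a F`. No self-symmetry of `G` or `F`. [cite: Washington1997, §7.1–§7.2 and §13.4; Matsumura1987, Thm. 20.3] -/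
theorem dvd_pow_mul_of_two_pencils (hmax : IsLocalRing.maximalIdeal 𝒪 = Ideal.span {(p : 𝒪)})
    (ρ : PowerSeries (PowerSeries 𝒪) ≃+* PowerSeries (PowerSeries 𝒪)) (hρc : ∀ c : 𝒪, ρ (const 𝒪 c) = const 𝒪 c)
    (hρT : ρ (T₂ 𝒪) ∉ Ideal.span {const 𝒪 (p : 𝒪), T₂ 𝒪})
    (G F : PowerSeries (PowerSeries 𝒪)) (hcomb : ThinCombDvdRat 𝒪 p G F)
    (hcomb' : ThinCombDvdRat 𝒪 p (ρ.symm G) (ρ.symm F)) : ∃ a : ℕ, G ∣ const 𝒪 ((p : 𝒪) ^ a) * F := by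
  obtain ⟨hp0, hpu, hprime, hpprime⟩ := p_ne_zero_of_maximalIdeal_eq 𝒪 p hmax
  have hcp : Prime (const 𝒪 (p : 𝒪)) :=
    Literature.NumberTheory.EllipticCurves.prime_C_of_prime (Literature.NumberTheory.EllipticCurves.prime_C_of_prime hpprime)
  have hρsc : ∀ c : 𝒪, ρ.symm (const 𝒪 c) = const 𝒪 c := fun c => by rw [RingEquiv.symm_apply_eq, hρc]
  by_cases hG0 : G = 0
  · subst hG0
    have := eq_zero_of_thinCombDvdRat_zero 𝒪 p hmax hcomb
    exact ⟨0, by rw [this, mul_zero]⟩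
  obtain ⟨n, G₀, hG₀p, rfl⟩ := WfDvdMonoid.max_power_factor' hG0 hcp.not_unit
  have hG₀0 : G₀ ≠ 0 := right_ne_zero_of_mul hG0
  have hlev : ∀ k : ℕ, ∃ m : ℕ, k ≤ m ∧
      ∃ t : ℕ, const 𝒪 ((p : 𝒪) ^ t) * F ∈ Ideal.span {G₀, combElt 𝒪 p m} := by
    intro k
    obtain ⟨m, hkm, t, hmem⟩ := hcomb k
    obtain ⟨a, b, hab⟩ := Ideal.mem_span_pair.mp hmem
    exact ⟨m, hkm, t, Ideal.mem_span_pair.mpr ⟨a * const 𝒪 (p : 𝒪) ^ n, b, by rw [← hab]; ring⟩⟩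
  have hlev' : ∀ k : ℕ, ∃ m : ℕ, k ≤ m ∧
      ∃ t : ℕ, const 𝒪 ((p : 𝒪) ^ t) * ρ.symm F ∈ Ideal.span {ρ.symm G₀, combElt 𝒪 p m} := by
    intro k
    obtain ⟨m, hkm, t, hmem⟩ := hcomb' k
    obtain ⟨a, b, hab⟩ := Ideal.mem_span_pair.mp hmem
    refine ⟨m, hkm, t, Ideal.mem_span_pair.mpr ⟨a * const 𝒪 (p : 𝒪) ^ n, b, ?_⟩⟩
    rw [← hab, map_mul, map_pow, hρsc]; ring
  obtain ⟨c, hc⟩ := pfree_dvd_of_two_pencils 𝒪 p hmax hρc hρT hG₀0 hG₀p hlev hlev'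
  exact ⟨n, c, by rw [map_pow, hc]; ring⟩

/-- **The `p`-power of an integral comb is detected coefficientwise**: if `F ∈ (p^n·G₀, E_m)` on levels of unbounded
order then `p^n ∣ F` (every `T₁`-coefficient of `F` reduces into `p^n·𝒪_m` on deep levels; Part II
`C_pow_dvd_of_mk_mem_span`). [cite: Washington1997, §7.1–§7.2] -/
theorem const_pow_dvd_of_thinCombDvdInt (hmax : IsLocalRing.maximalIdeal 𝒪 = Ideal.span {(p : 𝒪)}) {n : ℕ}
    {G₀ F : PowerSeries (PowerSeries 𝒪)} (hcombI : ThinCombDvdInt 𝒪 p (const 𝒪 (p : 𝒪) ^ n * G₀) F) :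
    const 𝒪 (p : 𝒪) ^ n ∣ F := by
  classical
  have hcoef : ∀ i, PowerSeries.C (p : 𝒪) ^ n ∣ PowerSeries.coeff i F := by
    intro i
    by_cases hg : PowerSeries.coeff i F = 0
    · rw [hg]; exact dvd_zero _
    obtain ⟨m₀, hm₀⟩ := C_pow_dvd_of_mk_mem_span 𝒪 p hmax hg
    obtain ⟨m, hm, hmem⟩ := hcombI m₀
    obtain ⟨a, b, hab⟩ := Ideal.mem_span_pair.mp hmem
    refine hm₀ m hm n ?_
    have hab' : PowerSeries.C (PowerSeries.C (p : 𝒪)) ^ n * (a * G₀) + b * combElt 𝒪 p m = F := by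
      rw [← hab]; simp only [const, RingHom.comp_apply]; ring
    have hi := congrArg (PowerSeries.coeff i) hab'
    rw [map_add, combElt, PowerSeries.coeff_mul_C, ← map_pow, ← map_pow, PowerSeries.coeff_C_mul,
      map_pow] at hi
    rw [← hi, map_add, map_mul, map_mul _ (PowerSeries.coeff i b),
      Ideal.Quotient.eq_zero_iff_mem.mpr (Ideal.mem_span_singleton_self (combSeries 𝒪 p m)), mul_zero,
      add_zero]
    refine Ideal.mul_mem_right _ _ ?_
    have : Ideal.Quotient.mk (Ideal.span {combSeries 𝒪 p m}) (PowerSeries.C (p : 𝒪) ^ n) =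
        (p : LevelRing 𝒪 p m) ^ n := by simp
    rw [this]; exact Ideal.mem_span_singleton_self _
  choose q hq using hcoef
  refine ⟨PowerSeries.mk q, ?_⟩
  ext i : 1
  rw [hq i, show const 𝒪 (p : 𝒪) ^ n = PowerSeries.C (PowerSeries.C (p : 𝒪) ^ n) by
    simp only [const, RingHom.comp_apply, map_pow], PowerSeries.coeff_C_mul, PowerSeries.coeff_mk]

/-- **TWO-PENCIL RIGIDITY, integral form**: an INTEGRAL comb of `(G, F)` and a rational comb of `(ρ⁻¹ G, ρ⁻¹ F)` give
`G ∣ F`. [cite: Washington1997, §7.1–§7.2 and §13.4; Matsumura1987, Thm. 20.3] -/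
theorem dvd_of_two_pencils (hmax : IsLocalRing.maximalIdeal 𝒪 = Ideal.span {(p : 𝒪)})
    (ρ : PowerSeries (PowerSeries 𝒪) ≃+* PowerSeries (PowerSeries 𝒪)) (hρc : ∀ c : 𝒪, ρ (const 𝒪 c) = const 𝒪 c)
    (hρT : ρ (T₂ 𝒪) ∉ Ideal.span {const 𝒪 (p : 𝒪), T₂ 𝒪})
    (G F : PowerSeries (PowerSeries 𝒪)) (hcombI : ThinCombDvdInt 𝒪 p G F)
    (hcomb' : ThinCombDvdRat 𝒪 p (ρ.symm G) (ρ.symm F)) : G ∣ F := by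
  classical
  obtain ⟨hp0, hpu, hprime, hpprime⟩ := p_ne_zero_of_maximalIdeal_eq 𝒪 p hmax
  haveI := Literature.NumberTheory.IwasawaTheory.uniqueFactorizationMonoid_powerSeries_powerSeries 𝒪
  have hcp : Prime (const 𝒪 (p : 𝒪)) :=
    Literature.NumberTheory.EllipticCurves.prime_C_of_prime (Literature.NumberTheory.EllipticCurves.prime_C_of_prime hpprime)
  have hρsc : ∀ c : 𝒪, ρ.symm (const 𝒪 c) = const 𝒪 c := fun c => by rw [RingEquiv.symm_apply_eq, hρc]
  have hcomb : ThinCombDvdRat 𝒪 p G F := ThinCombDvdInt.thinCombDvdRat hcombI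
  by_cases hG0 : G = 0
  · subst hG0
    rw [eq_zero_of_thinCombDvdRat_zero 𝒪 p hmax hcomb]
  obtain ⟨n, G₀, hG₀p, rfl⟩ := WfDvdMonoid.max_power_factor' hG0 hcp.not_unit
  have hG₀0 : G₀ ≠ 0 := right_ne_zero_of_mul hG0
  have hlev : ∀ k : ℕ, ∃ m : ℕ, k ≤ m ∧
      ∃ t : ℕ, const 𝒪 ((p : 𝒪) ^ t) * F ∈ Ideal.span {G₀, combElt 𝒪 p m} := by
    intro k
    obtain ⟨m, hkm, t, hmem⟩ := hcomb k
    obtain ⟨a, b, hab⟩ := Ideal.mem_span_pair.mp hmem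
    exact ⟨m, hkm, t, Ideal.mem_span_pair.mpr ⟨a * const 𝒪 (p : 𝒪) ^ n, b, by rw [← hab]; ring⟩⟩
  have hlev' : ∀ k : ℕ, ∃ m : ℕ, k ≤ m ∧
      ∃ t : ℕ, const 𝒪 ((p : 𝒪) ^ t) * ρ.symm F ∈ Ideal.span {ρ.symm G₀, combElt 𝒪 p m} := by
    intro k
    obtain ⟨m, hkm, t, hmem⟩ := hcomb' k
    obtain ⟨a, b, hab⟩ := Ideal.mem_span_pair.mp hmem
    refine ⟨m, hkm, t, Ideal.mem_span_pair.mpr ⟨a * const 𝒪 (p : 𝒪) ^ n, b, ?_⟩⟩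
    rw [← hab, map_mul, map_pow, hρsc]; ring
  have h1 : G₀ ∣ F := pfree_dvd_of_two_pencils 𝒪 p hmax hρc hρT hG₀0 hG₀p hlev hlev'
  have h2 : const 𝒪 (p : 𝒪) ^ n ∣ F := const_pow_dvd_of_thinCombDvdInt 𝒪 p hmax hcombI
  have hrel : IsRelPrime (const 𝒪 (p : 𝒪) ^ n) G₀ :=
    ((hcp.irreducible.isRelPrime_iff_not_dvd).mpr hG₀p).pow_left
  exact hrel.mul_dvd h2 h1

/-- **Rigidity from ONE-SIDED functional equations** (a weakening of Part VII for non-involutive `ρ`): `ρ` fixes constants,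
`ρ T₂ ∉ (p, T₂)`, `G ∣ ρ G`, `ρ F ∣ F` and the rational comb of `(G, F)` give `G ∣ p^a F` — the second pencil is
`ThinCombDvdRat.symm_of_dvd`. [cite: Washington1997, §7.1–§7.2 and §13.4; Matsumura1987, Thm. 20.3] -/
theorem dvd_pow_mul_of_oneSided (hmax : IsLocalRing.maximalIdeal 𝒪 = Ideal.span {(p : 𝒪)})
    (ρ : PowerSeries (PowerSeries 𝒪) ≃+* PowerSeries (PowerSeries 𝒪)) (hρc : ∀ c : 𝒪, ρ (const 𝒪 c) = const 𝒪 c)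
    (hρT : ρ (T₂ 𝒪) ∉ Ideal.span {const 𝒪 (p : 𝒪), T₂ 𝒪})
    (G F : PowerSeries (PowerSeries 𝒪)) (hG : G ∣ ρ G) (hF : ρ F ∣ F) (hcomb : ThinCombDvdRat 𝒪 p G F) :
    ∃ a : ℕ, G ∣ const 𝒪 ((p : 𝒪) ^ a) * F :=
  dvd_pow_mul_of_two_pencils 𝒪 p hmax ρ hρc hρT G F hcomb (ThinCombDvdRat.symm_of_dvd hcomb ρ hG hF)

end TwoPencils

/-! ## §2 Group-like currency `ρ = φ_A` and the receptacle `R₀ = unrIntegers p` -/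

section Frame

variable (𝒪 : Type*) [CommRing 𝒪] [IsDomain 𝒪] [IsDiscreteValuationRing 𝒪] (p : ℕ) [hp : Fact p.Prime]
  [Algebra ℤ_[p] 𝒪]

/-- **Two-pencil rigidity for `φ_A`**: `A 0 1 ≠ 0`, the rational combs of `(G, F)` and of `(φ_{A⁻¹} G, φ_{A⁻¹} F)` give
`G ∣ p^a F` (`φ_A` fixes constants; `φ_A T₂ ∉ (p, T₂) ⟺ A 0 1 ≠ 0`, `…GroupLikeReflection`; `φ_A⁻¹ = φ_{A⁻¹}`).
[cite: NeukirchSchmidtWingberg2008, (5.3.5)] [cite: Washington1997, §7.1–§7.2 and §13.4] -/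
theorem dvd_pow_mul_of_two_pencils_frameSubst (hmax : IsLocalRing.maximalIdeal 𝒪 = Ideal.span {(p : 𝒪)})
    (A : GL (Fin 2) ℤ_[p]) (hb : (A : Matrix (Fin 2) (Fin 2) ℤ_[p]) 0 1 ≠ 0) (G F : PowerSeries (PowerSeries 𝒪))
    (hcomb : ThinCombDvdRat 𝒪 p G F)
    (hcomb' : ThinCombDvdRat 𝒪 p (IwasawaAlgebra₂.frameSubst 𝒪 A⁻¹ G) (IwasawaAlgebra₂.frameSubst 𝒪 A⁻¹ F)) :
    ∃ a : ℕ, G ∣ const 𝒪 ((p : 𝒪) ^ a) * F := by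
  obtain ⟨-, hpu, -, -⟩ := p_ne_zero_of_maximalIdeal_eq 𝒪 p hmax
  refine dvd_pow_mul_of_two_pencils 𝒪 p hmax (IwasawaAlgebra₂.frameSubst 𝒪 A)
    (GroupLikeReflection.frameSubst_const 𝒪 A) (GroupLikeReflection.frameSubst_T₂_not_mem 𝒪 A hpu hb) G F hcomb ?_
  rwa [IwasawaAlgebra₂.frameSubst_symm]

/-- **Two-pencil rigidity for `φ_A` over `R₀`** (`ℤ_p`-algebra through `toUnr p`): `A 0 1 ≠ 0`, rational combs of `(G, F)`
and of `(φ_{A⁻¹} G, φ_{A⁻¹} F)` give `G ∣ p^a F`. [cite: NeukirchSchmidtWingberg2008, (5.3.5)] [cite: Washington1997, §7.1–§7.2 and §13.4] -/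
theorem dvd_pow_mul_of_two_pencils_frameSubst_unr (A : GL (Fin 2) ℤ_[p])
    (hb : (A : Matrix (Fin 2) (Fin 2) ℤ_[p]) 0 1 ≠ 0) (G F : PowerSeries (UnrSeries p)) :
    letI : Algebra ℤ_[p] (unrIntegers p) := (toUnr p).toAlgebra
    ThinCombDvdRat (unrIntegers p) p G F →
      ThinCombDvdRat (unrIntegers p) p (IwasawaAlgebra₂.frameSubst (unrIntegers p) A⁻¹ G)
        (IwasawaAlgebra₂.frameSubst (unrIntegers p) A⁻¹ F) →
      ∃ a : ℕ, G ∣ const (unrIntegers p) (((p : ℕ) : unrIntegers p) ^ a) * F := by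
  letI : Algebra ℤ_[p] (unrIntegers p) := (toUnr p).toAlgebra
  intro hcomb hcomb'
  letI := Summit.BirchSwinnertonDyer.Rank1Residual.X2.HidaLimitAlgebra.isDiscreteValuationRing_unrIntegers (p := p)
  exact dvd_pow_mul_of_two_pencils_frameSubst (unrIntegers p) p (GroupLikeReflection.maximalIdeal_unrIntegers_eq p)
    A hb G F hcomb hcomb'

end Frame

end Summit.BirchSwinnertonDyer.BirchSwinnertonDyer.Theorems.UniversalToricDescentThinComb.TwoPencilRigidity

end
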